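import Mathlib
import HarnessLib
import Summits.ValiantsHypothesis.ValiantsHypothesis.Theorems.LacunarySymmetroidMatrixDescartesOsculationLawPeelLocalBranch

/-!
# ValiantsHypothesis / LacunarySymmetroid — crux `MatrixDescartes` (stmt-ValiantsHypothesis-18050, V1),
# line `Cruxes/MatrixDescartes/Lines/osculation_law.lean` («osculation-law»), stub `stub_peel` (ALL ranks):
# CONTINUOUS BRANCHES ARE SMOOTH (rank-free; regularity transfer for piece (α)/(γ) of NOTE-p7g12-peel-general-r-sizing.md)

A merely CONTINUOUS positive solution `b = β(t)` of `Φ(t, b) = 0` on an open interval `(α, ω)`, `α ≥ 0`, of a hyperbolic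
family with finite osculation set in general position coincides near each point with the local implicit branch
(`…PeelLocalBranch`, local uniqueness), hence is `C^ω` at every point; in particular it carries the `HasDerivAt` data
(`β' = deriv β`, `β'' = deriv (deriv β)`) that the branch-arc ENGINE `card_roots_filter_branchArc_le_two` consumes.

* **`contDiffAt_of_solution`**, `contDiffOn_of_solution`, **`hasDerivAt_of_solution`**.

Honest framing: a rank-free LEMMA toward the OPEN stub `stub_peel` (all `r`); nothing of the summit is proved; `VP ≠ VNP` is
NOT proved.  No definitions, no named facts.
-/

-- `Summit.ValiantsHypothesis.ValiantsHypothesis.…` is the tree's mandated single-conjunct layout (Sub = Summit).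
set_option linter.dupNamespace false

noncomputable section

namespace Summit.ValiantsHypothesis.ValiantsHypothesis.Theorems.LacunarySymmetroidMatrixDescartes

open Polynomial Set Filter
open MvPolynomial (pderiv)
open scoped BigOperators Topology

namespace OsculationPeel

section

variable (Φ : MvPolynomial (Fin 2) ℝ) (P : ℝ → ℝ[X])
    (hP : ∀ t b, (P t).eval b = MvPolynomial.eval ![t, b] Φ) (hsplit : ∀ t, 0 < t → (P t).Splits)
    (hfin : {p : Fin 2 → ℝ | 0 < p 0 ∧ 0 < p 1 ∧ MvPolynomial.eval p Φ = 0 ∧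
      MvPolynomial.eval p
        (MvPolynomial.X 0 * MvPolynomial.pderiv 0 (MvPolynomial.X 0 * MvPolynomial.pderiv 0 Φ)
            * (MvPolynomial.X 1 * MvPolynomial.pderiv 1 Φ) ^ 2
          - 2 * (MvPolynomial.X 0 * MvPolynomial.pderiv 0 (MvPolynomial.X 1 * MvPolynomial.pderiv 1 Φ))
            * (MvPolynomial.X 0 * MvPolynomial.pderiv 0 Φ) * (MvPolynomial.X 1 * MvPolynomial.pderiv 1 Φ)
          + MvPolynomial.X 1 * MvPolynomial.pderiv 1 (MvPolynomial.X 1 * MvPolynomial.pderiv 1 Φ)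
            * (MvPolynomial.X 0 * MvPolynomial.pderiv 0 Φ) ^ 2) = 0}.Finite)
    (hgp : ∀ p ∈ {p : Fin 2 → ℝ | 0 < p 0 ∧ 0 < p 1 ∧ MvPolynomial.eval p Φ = 0 ∧
      MvPolynomial.eval p
        (MvPolynomial.X 0 * MvPolynomial.pderiv 0 (MvPolynomial.X 0 * MvPolynomial.pderiv 0 Φ)
            * (MvPolynomial.X 1 * MvPolynomial.pderiv 1 Φ) ^ 2
          - 2 * (MvPolynomial.X 0 * MvPolynomial.pderiv 0 (MvPolynomial.X 1 * MvPolynomial.pderiv 1 Φ))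
            * (MvPolynomial.X 0 * MvPolynomial.pderiv 0 Φ) * (MvPolynomial.X 1 * MvPolynomial.pderiv 1 Φ)
          + MvPolynomial.X 1 * MvPolynomial.pderiv 1 (MvPolynomial.X 1 * MvPolynomial.pderiv 1 Φ)
            * (MvPolynomial.X 0 * MvPolynomial.pderiv 0 Φ) ^ 2) = 0},
        MvPolynomial.eval p (MvPolynomial.pderiv 1 Φ) ≠ 0)

include hP hsplit hfin hgp

/-- **Continuous branches are smooth**: a continuous positive solution on `(α, ω)`, `α ≥ 0`, is `C^ω` at each point
(it coincides near the point with the local implicit branch). [folklore] -/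
theorem contDiffAt_of_solution {α ω : ℝ} {β : ℝ → ℝ} (hα : 0 ≤ α) (hcont : ContinuousOn β (Ioo α ω))
    (hpos : ∀ t ∈ Ioo α ω, 0 < β t) (hsol : ∀ t ∈ Ioo α ω, MvPolynomial.eval ![t, β t] Φ = 0)
    {t : ℝ} (ht : t ∈ Ioo α ω) : ContDiffAt ℝ ⊤ β t := by
  obtain ⟨ψ, hψt, hψcd, -, hU⟩ := exists_local_branch_of_hyperbolic Φ P hP hsplit hfin hgp (hα.trans_lt ht.1)
    (hpos t ht) (hsol t ht)
  have hβc : ContinuousAt β t := (hcont t ht).continuousAt (Ioo_mem_nhds ht.1 ht.2)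
  have hcurve : Tendsto (fun u => ((u, β u) : ℝ × ℝ)) (𝓝 t) (𝓝 (t, β t)) :=
    (continuous_id.tendsto t).prodMk_nhds hβc
  have h1 := hcurve.eventually hU
  have h2 : ∀ᶠ u in 𝓝 t, MvPolynomial.eval ![u, β u] Φ = 0 :=
    mem_of_superset (Ioo_mem_nhds ht.1 ht.2) fun u hu => hsol u hu
  have heq : β =ᶠ[𝓝 t] ψ := by
    filter_upwards [h1, h2] with u hu hu0
    exact (hu.1 hu0).symm
  exact hψcd.congr_of_eventuallyEq heq

/-- … hence `C^ω` on the interval. [folklore] -/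
theorem contDiffOn_of_solution {α ω : ℝ} {β : ℝ → ℝ} (hα : 0 ≤ α) (hcont : ContinuousOn β (Ioo α ω))
    (hpos : ∀ t ∈ Ioo α ω, 0 < β t) (hsol : ∀ t ∈ Ioo α ω, MvPolynomial.eval ![t, β t] Φ = 0) :
    ContDiffOn ℝ ⊤ β (Ioo α ω) := fun _ ht =>
  (contDiffAt_of_solution Φ P hP hsplit hfin hgp hα hcont hpos hsol ht).contDiffWithinAt

/-- **The ENGINE's derivative data**: `β' = deriv β`, `β'' = deriv (deriv β)` along a continuous positive solution.
[folklore] -/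
theorem hasDerivAt_of_solution {α ω : ℝ} {β : ℝ → ℝ} (hα : 0 ≤ α) (hcont : ContinuousOn β (Ioo α ω))
    (hpos : ∀ t ∈ Ioo α ω, 0 < β t) (hsol : ∀ t ∈ Ioo α ω, MvPolynomial.eval ![t, β t] Φ = 0) :
    ∀ s ∈ Ioo α ω, HasDerivAt β (deriv β s) s ∧ HasDerivAt (deriv β) (deriv (deriv β) s) s := by
  have hon := contDiffOn_of_solution Φ P hP hsplit hfin hgp hα hcont hpos hsol
  have hon' : ContDiffOn ℝ ⊤ (deriv β) (Ioo α ω) := hon.deriv_of_isOpen isOpen_Ioo (by simp)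
  intro s hs
  have hnhds : Ioo α ω ∈ 𝓝 s := Ioo_mem_nhds hs.1 hs.2
  refine ⟨((hon.differentiableOn (by simp)).differentiableAt hnhds).hasDerivAt,
    ((hon'.differentiableOn (by simp)).differentiableAt hnhds).hasDerivAt⟩

end

end OsculationPeel

end Summit.ValiantsHypothesis.ValiantsHypothesis.Theorems.LacunarySymmetroidMatrixDescartes

end
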